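import Literature.MathematicalPhysics.StatisticalMechanics.LennardJonesClusters

/-!
# drefute evidence for line `c-layer-witness-strictness` (crux `SlackRigidity`, stmt-AtomisticToContinuum-11960):
a sorry-free proof of `stub_thinning` (thinning of near-minimisers, `K = 10⁴`)

POSITIVE evidence (refuter seat `refuter-drefute-stmt-AtomisticToContinuum-11960-0`): the stub as registered is
TRUE; `stub_thinning_proof` proves its statement verbatim (with the witness `K = 10000`).

Proof (Blanc–Lewin 2015 §2.2 / Xue 1997 bookkeeping): induction on `N`.  If `x` is `1/3`-separated take `y = x`
(`0 ≤ 𝓔(x) − E(N)` by `groundStateEnergy_lennardJones_le`).  Otherwise pick a closest pair `(i₀, j₀)`,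
`r = |x_{i₀} − x_{j₀}| < 1/3`; the configuration is `r`-separated, so by the tree's shell sum
`sum_inv_pow_six_le` the site energy of `i₀` is `≥ u²/12 − (250/6)·u ≥ 10⁴` (`u = r⁻⁶ > 729`); removing `i₀`
(`interactionEnergy_eq_succAbove_add_siteEnergy`: `𝓔(x) = 𝓔(x ∘ i₀.succAbove) + 𝓔^{i₀}(x)`) lowers the energy
by `≥ 10⁴`, and `E(n) ≥ E(n+1)` (`groundStateEnergy_succ_le`, from the tree's strict binding
`groundStateEnergy_add_lt` with a one-particle cluster); apply the induction hypothesis to the remaining `n` points.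
-/

noncomputable section

namespace Summit.AtomisticToContinuum.Crystallization.Cruxes.SlackRigidity.DrefuteEvidence

open Literature.MathematicalPhysics.StatisticalMechanics

/-- Ambient space `ℝ³`. -/
local notation "E3" => EuclideanSpace ℝ (Fin 3)

/-! ## Removing one particle -/

/-- The site energy of `i` as a sum over the other particles, indexed by `Fin n` through `i.succAbove`.
[folklore] -/
theorem siteEnergy_eq_sum_succAbove (V : ℝ → ℝ) {n : ℕ} (x : Fin (n + 1) → E3) (i : Fin (n + 1)) :
    siteEnergy V x i = ∑ c : Fin n, V (dist (x i) (x (i.succAbove c))) := by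
  unfold siteEnergy
  have h := Fin.sum_univ_succAbove (fun k => V (dist (x i) (x k))) i
  rw [← Finset.add_sum_erase _ _ (Finset.mem_univ i)] at h
  linarith

/-- **Removal identity**: for `V 0 = 0`, `𝓔(x) = 𝓔(x with particle i removed) + 𝓔ⁱ(x)`. [folklore] -/
theorem interactionEnergy_eq_succAbove_add_siteEnergy {V : ℝ → ℝ} (hV : V 0 = 0) {n : ℕ}
    (x : Fin (n + 1) → E3) (i : Fin (n + 1)) :
    interactionEnergy V x = interactionEnergy V (x ∘ i.succAbove) + siteEnergy V x i := by
  have h1 := two_mul_interactionEnergy_eq_sum_sum V hV x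
  have h2 := two_mul_interactionEnergy_eq_sum_sum V hV (x ∘ i.succAbove)
  rw [Fin.sum_univ_succAbove _ i] at h1
  have hrow : ∀ a : Fin (n + 1), ∑ k, V (dist (x a) (x k)) =
      V (dist (x a) (x i)) + ∑ c : Fin n, V (dist (x a) (x (i.succAbove c))) := fun a =>
    Fin.sum_univ_succAbove (fun k => V (dist (x a) (x k))) i
  simp only [hrow, dist_self, hV, zero_add, Finset.sum_add_distrib] at h1
  simp only [Function.comp_apply] at h2
  have hsym : ∑ c : Fin n, V (dist (x (i.succAbove c)) (x i)) =
      ∑ c : Fin n, V (dist (x i) (x (i.succAbove c))) :=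
    Finset.sum_congr rfl fun c _ => by rw [dist_comm]
  rw [siteEnergy_eq_sum_succAbove]
  linarith

/-! ## The site energy at a closest pair -/

/-- **Site energy at a closest pair.** If `(i₀, j₀)` realises the minimal distance `r < 1/3` of `x`, the
Lennard-Jones site energy of `i₀` is at least `10⁴`: `𝓔^{i₀} ≥ u²/12 − (250/6) u` with `u = r⁻⁶ > 729`
(shell sum `sum_inv_pow_six_le`). [cite: BlancLewin2015, §2.2; Xue1997] -/
theorem siteEnergy_ge_of_closestPair {N : ℕ} (x : Fin N → E3) {i₀ j₀ : Fin N} (hne : i₀ ≠ j₀)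
    (hpos : 0 < dist (x i₀) (x j₀))
    (hmin : ∀ k l, k ≠ l → dist (x i₀) (x j₀) ≤ dist (x k) (x l))
    (hr : dist (x i₀) (x j₀) < 1 / 3) :
    (10000 : ℝ) ≤ siteEnergy lennardJones x i₀ := by
  have hshell := sum_inv_pow_six_le x hpos hmin i₀
  have hsum : siteEnergy lennardJones x i₀ =
      (1 / 12) * ∑ k ∈ Finset.univ.erase i₀, (dist (x i₀) (x k))⁻¹ ^ 12 -
        (1 / 6) * ∑ k ∈ Finset.univ.erase i₀, (dist (x i₀) (x k))⁻¹ ^ 6 := by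
    unfold siteEnergy lennardJones
    rw [Finset.mul_sum, Finset.mul_sum, ← Finset.sum_sub_distrib]
  have h12 : (dist (x i₀) (x j₀))⁻¹ ^ 12 ≤ ∑ k ∈ Finset.univ.erase i₀, (dist (x i₀) (x k))⁻¹ ^ 12 :=
    Finset.single_le_sum (f := fun k => (dist (x i₀) (x k))⁻¹ ^ 12) (fun k _ => by positivity)
      (Finset.mem_erase.2 ⟨hne.symm, Finset.mem_univ _⟩)
  have h3 : (3 : ℝ) < (dist (x i₀) (x j₀))⁻¹ := by
    rw [lt_inv_comm₀ (by norm_num) hpos]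
    rw [show (3 : ℝ)⁻¹ = 1 / 3 by norm_num]
    exact hr
  have hu : (729 : ℝ) < (dist (x i₀) (x j₀))⁻¹ ^ 6 := by
    calc (729 : ℝ) = 3 ^ 6 := by norm_num
      _ < _ := pow_lt_pow_left₀ h3 (by norm_num) (by norm_num)
  set u := (dist (x i₀) (x j₀))⁻¹ ^ 6 with hu_def
  have hu12 : (dist (x i₀) (x j₀))⁻¹ ^ 12 = u ^ 2 := by rw [hu_def, ← pow_mul]
  rw [hu12] at h12
  rw [hsum]
  nlinarith [h12, hshell, hu, mul_nonneg (sub_nonneg.2 hu.le) (by positivity : (0 : ℝ) ≤ u + 229)]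

/-! ## `N ↦ E(N)` is non-increasing -/

/-- With at most one particle the ground-state energy vanishes. [folklore] -/
theorem groundStateEnergy_eq_zero_of_le_one {N : ℕ} (hN : N ≤ 1) :
    groundStateEnergy lennardJones 3 N = 0 := by
  haveI : Subsingleton (Fin N) := Fin.subsingleton_iff_le_one.2 hN
  haveI : Nonempty {x : Fin N → E3 // Function.Injective x} := nonempty_injective_config (by norm_num) N
  unfold groundStateEnergy
  have : ∀ x : {x : Fin N → E3 // Function.Injective x}, interactionEnergy lennardJones x.1 = 0 :=
    fun x => interactionEnergy_of_subsingleton lennardJones x.1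
  simp only [this, ciInf_const]

/-- **`E(n+1) ≤ E(n)`** for Lennard-Jones in `ℝ³` (add a far-away particle; here from the tree's strict binding
inequality `groundStateEnergy_add_lt` with a one-particle cluster and `E(1) = 0`). [cite: BlancLewin2015, §1.2 (6)] -/
theorem groundStateEnergy_succ_le (n : ℕ) :
    groundStateEnergy lennardJones 3 (n + 1) ≤ groundStateEnergy lennardJones 3 n := by
  rcases Nat.eq_zero_or_pos n with rfl | hn
  · rw [groundStateEnergy_eq_zero_of_le_one le_rfl, groundStateEnergy_eq_zero_of_le_one zero_le_one]
  · obtain ⟨y, hy⟩ := LennardJonesGroundStatesExist_holds n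
    obtain ⟨z, hz⟩ := LennardJonesGroundStatesExist_holds 1
    have h := groundStateEnergy_add_lt (by norm_num : 0 < 3) hn one_pos hy hz
    rw [groundStateEnergy_eq_zero_of_le_one le_rfl, add_zero] at h
    exact h.le

/-- `E(M) ≥ E(N)` for `M ≤ N`. [folklore] -/
theorem groundStateEnergy_antitone {M N : ℕ} (h : M ≤ N) :
    groundStateEnergy lennardJones 3 N ≤ groundStateEnergy lennardJones 3 M := by
  induction h with
  | refl => exact le_rfl
  | step _ ih => exact (groundStateEnergy_succ_le _).trans ih

/-! ## The stub -/

/-- **`stub_thinning` of line `c-layer-witness-strictness`, verbatim, sorry-free** (witness `K = 10⁴`): every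
injective configuration contains a `1/3`-separated sub-configuration with no larger energy, the deletions being
paid out of the excess, `10⁴ · (N − M) ≤ 𝓔(x) − E(N)`. [cite: BlancLewin2015, §2.2; Xue1997] -/
theorem stub_thinning_proof :
    ∃ K : ℝ, 0 < K ∧ ∀ (N : ℕ) (x : Fin N → E3), Function.Injective x →
      ∃ (M : ℕ) (y : Fin M → E3), Function.Injective y ∧ Set.range y ⊆ Set.range x ∧
        (∀ i j : Fin M, i ≠ j → (1 / 3 : ℝ) ≤ dist (y i) (y j)) ∧ M ≤ N ∧
        K * ((N : ℝ) - M) ≤ interactionEnergy lennardJones x - groundStateEnergy lennardJones 3 N ∧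
        interactionEnergy lennardJones y ≤ interactionEnergy lennardJones x := by
  refine ⟨10000, by norm_num, fun N => ?_⟩
  induction N with
  | zero =>
    intro x hx
    refine ⟨0, x, hx, subset_rfl, fun i => i.elim0, le_rfl, ?_, le_rfl⟩
    rw [Nat.cast_zero, sub_self, mul_zero, sub_nonneg]
    exact groundStateEnergy_lennardJones_le hx
  | succ n ih =>
    intro x hx
    by_cases hsep : ∀ i j : Fin (n + 1), i ≠ j → (1 / 3 : ℝ) ≤ dist (x i) (x j)
    · refine ⟨n + 1, x, hx, subset_rfl, hsep, le_rfl, ?_, le_rfl⟩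
      rw [sub_self, mul_zero, sub_nonneg]
      exact groundStateEnergy_lennardJones_le hx
    · push Not at hsep
      obtain ⟨i, j, hij, hlt⟩ := hsep
      -- a closest pair `(i₀, j₀)`
      obtain ⟨p, hp, hmin⟩ := Finset.exists_min_image Finset.univ.offDiag
        (fun p : Fin (n + 1) × Fin (n + 1) => dist (x p.1) (x p.2)) ⟨(i, j), by simp [hij]⟩
      obtain ⟨i₀, j₀⟩ := p
      have hij₀ : i₀ ≠ j₀ := by simpa using hp
      have hmin' : ∀ k l, k ≠ l → dist (x i₀) (x j₀) ≤ dist (x k) (x l) := fun k l hkl =>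
        hmin (k, l) (by simp [hkl])
      have hr : dist (x i₀) (x j₀) < 1 / 3 := (hmin' i j hij).trans_lt hlt
      have hpos : 0 < dist (x i₀) (x j₀) := dist_pos.2 (hx.ne hij₀)
      have hsite := siteEnergy_ge_of_closestPair x hij₀ hpos hmin' hr
      -- remove `i₀` and recurse
      have hx' : Function.Injective (x ∘ i₀.succAbove) := hx.comp Fin.succAbove_right_injective
      obtain ⟨M, y, hy, hyr, hysep, hMn, hK, hEy⟩ := ih (x ∘ i₀.succAbove) hx'
      have hErem := interactionEnergy_eq_succAbove_add_siteEnergy lennardJones_zero x i₀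
      have hmono := groundStateEnergy_succ_le n
      refine ⟨M, y, hy, hyr.trans (Set.range_comp_subset_range _ _), hysep, hMn.trans n.le_succ, ?_, ?_⟩
      · push_cast
        linarith
      · linarith

end Summit.AtomisticToContinuum.Crystallization.Cruxes.SlackRigidity.DrefuteEvidence

end
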